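import Literature.AnabelianGeometry.EtaleTheta.InducesOnThetaInstancesChiCusp
import Literature.AnabelianGeometry.EtaleTheta.Discharge.Sec2Cor28iiiOuterEndKnitChiCusp
import Literature.AnabelianGeometry.EtaleTheta.Discharge.Sec2Prop24OfCoreExtension
import HarnessLib

/-!
# [EtTh] Cor 2.8 (iii), OUTER clauses 3–4 at the cusped inversion model `χ′`: the binders `hY`/`hYuu` of abc-iut-L2-t2's
# `Cor28_iii` are THEOREMS where the clauses use them — residual `(Γ_Θ, InducesOnTheta)` only (proof-only)

S. Mochizuki, *The étale theta function and its Frobenioid-theoretic manifestations* [EtTh], Publ. RIMS **45** (2009)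
(refereed), §2, Cor 2.8 (iii), PRIMS PDF p.42 (own render `paper:doi-10-2977-prims-1234361159` p0042): «(iii) If the data for
`□ = α, β` are equal, and `γ` arises [cf. Proposition 2.6] from an inner automorphism of `Π^tp_{Ẋ̲̲}` (respectively, …), then `γ`
preserves `η̲̈^{Θ,l·ℤ}` (respectively, …) [i.e., without any constant multiple indeterminacy]»; proof: «… assertion (iii) follows
immediately from Remark 1.9.1»; Def 2.3 p.38 (`Π_{X̲̲}`, `Π_{C̲̲}`; Prop 2.2 (iii) `Π_{X̲̲} = Π_{C̲̲} ∩ Π_X`) (bib key `MochizukiEtTh2009`).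

PROOF-ONLY companion (0 `def`, 0 `instance`, 0 notation, no new `Prop`; cell abc-iut, block F, seat abc-iut-f-193 gen 15; abc-iut-L2-lead
R1432 «OUTER Cor28_iii hYuu RIDER»; node EtTh:Cor2.8(iii) is already discharged AS TYPED by abc-iut-w6-d049's
`cor28_iii_endKnit_inversionModelχ'`; every input BY NAME, nothing restated).  abc-iut-L2-t2's `ThetaOrbitData.Cor28_iii` carries the
stabilities `hY : γ_x(Π^tp_Ÿ) = Π^tp_Ÿ`, `hYuu : γ_x(Π^tp_Ÿ ∩ Π^tp_{X̲̲}) = Π^tp_Ÿ ∩ Π^tp_{X̲̲}` as HYPOTHESES of every clause (print has no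
such proviso).  At abc-iut-L2-d3's section-route cover over abc-iut-w5-d140's `MuTwoSetting.inversionModelχ′` they are THEOREMS where used:
* §1 (interface, any `T`) `TemperedCoverData.map_tp_PiXuu_innerAutTop_eq_of_mem_tp_PiCuu` — `y ∈ Π^tp_{C̲̲}` ⇒ `γ_y(Π^tp_{X̲̲}) = Π^tp_{X̲̲}`
  (`Π_X ⊴ Π_C`; abc-iut-w6-d051's `mem_tp_PiXuu_iff_of_mem_tp_PiCuu`), hence `…inf…_of_mem_tp_PiCuu`: `hYuu` from `hY` for such `y`
  (this seat's `map_PiYddtp_inf_tp_PiXuu_eq`, p520114);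
* §2 `SettingModel.map_PiYddtp_inf_tp_PiXuu_innerAutTop_ofHuuOfSection_of_mem_tp_PiCuu` — at the χ′ cover `hYuu` holds for EVERY
  `y ∈ Π^tp_{C̲̲}` (`hY` for every `y`: `Π^tp_Ÿ ⊴ Π^tp_C` there, this seat's `map_PiYddtp_innerAutTop_ofHuuOfSection`, p520114);
* §3 **`SettingModel.cor28_iii_outer_endKnit_inversionModelχ'_of_induces`** — clauses 3–4 of `Cor28_iii` at
  `ofEmbedding (orbitEmbeddingOfHuuOfSection …)` over `χ′` for EVERY conjugator `y ∈ Π^tp_C`, RE-KEYED: residual = `Γ_Θ` with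
  `InducesOnTheta γ_y Γ_Θ` ONLY (inhabited exactly once: `existsUnique_inducesOnTheta_innerAutTop_ofHuuOfSection`, p520114).  Clause 3
  (`y ∈ Π^tp_{Ċ̲̲}`) = abc-iut-w6-d050's `cor28_iii_outer_endKnit_inversionModelχ'` (p473918) with `hYmap`/`hYuu` supplied by §2 from the
  premise; clause 4 (`y ∈ Π^tp_{Ċ̲}`, which yields NO `hYuu` — `Π_{X̲̲}` need not be normal in `Π_{C̲} = Π_{C̲̲}·Δ̄_Θ`) is re-assembled
  `hYuu`-free one level below, from abc-iut-w6-d049's `ofEmbedding_transport_outer_etaLZ` (p436513), abc-iut-w6-d051's reductions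
  `stab_DeltaTheta_of_induces` / `stab_GtpYdd_of_map_PiYddtp` / `stab_GtpXu_of_mem_tp_PiCu` and abc-iut-w6-d050's junction
  `exists_mem_dotXuu_pC5_inversionModelχ'` (P-C5 with its dotted witness) — the path of `ofEmbedding_cor28_iii_outer_reduced`.
* v2 (append-only; v1 declarations byte-identical; one import added, `Sec2Prop24OfCoreExtension`, for `tp_PiXuu_le_tp_PiCuu`):
  §4 `SettingModel.cor28_iii_inner_endKnit_inversionModelχ'_of_induces` — the INNER twin: clauses 1–2 re-keyed the same way over
  abc-iut-L2-t2's clause-wise `ofEmbedding_transport_inner_rootLZ` / `…_etaLZ` (p427195; `hYuu` := §2 since `Π^tp_{X̲̲} ≤ Π^tp_{C̲̲}`,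
  `hY` := §2-normality, `ι(Π^tp_{X̲}) = T.tp T.PiXu` := abc-iut-w6-d049's `orbitEmbeddingOfHuuOfSection_map_GtpXu`); §5
  **`SettingModel.cor28_iii_printShape_inversionModelχ'_of_induces`** — Cor 2.8 (iii) in PRINT SHAPE at the cover of record: for EVERY
  `y ∈ Π^tp_C` and every `Γ_Θ` induced by `γ_y`, ALL FOUR clauses with NO stability proviso (§4 + §3); abc-iut-w6-d049's
  `cor28_iii_endKnit_inversionModelχ'` (`Cor28_iii` AS TYPED) is the special case speaking only for conjugators supplied with `hY`/`hYuu`.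
HONEST FRAMING: semi-synthetic model cover = consistency / non-vacuity evidence for the TYPED interface only; the constructor's data
binders (`op`, `s`/`hsa`/`hsZ`/`hsH`, `hιell`, `hN`, `hY`, `hK`, `IotaStable`, `τ`, `τ′`, `hE`, `hC`) stay displayed exactly as in p473918;
[EtTh] is refereed and nothing of it is asserted beyond the displayed statements; no side is taken on [IUTchIII] Cor 3.12; typed ≠ proved;
instantiated ≠ endorsed; nothing here bears on abc itself.
-/

noncomputable section

namespace Literature.AnabelianGeometry.EtaleTheta

open Literature.AnabelianGeometry.SemiGraphs ThetaCovers Literature.IUT.HodgeArakelov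
open _root_.Topology _root_.Function

universe u

/-! ## §1. Interface: `y ∈ Π^tp_{C̲̲}` normalises `Π^tp_{X̲̲}`, hence `hYuu` from `hY` (any `T`) -/

namespace ThetaCovers.TemperedCoverData

variable {l : ℕ} (T : TemperedCoverData.{u} l)

/-- **`γ_y(Π^tp_{X̲̲}) = Π^tp_{X̲̲}` for `y ∈ Π^tp_{C̲̲}`** (`Π_{X̲̲} = Π_{C̲̲} ∩ Π_X`, `Π_X ⊴ Π_C`, pulled back to `Π^tp_C`).
[cite: MochizukiEtTh2009, Def 2.3 p.38] -/
theorem map_tp_PiXuu_innerAutTop_eq_of_mem_tp_PiCuu {y : T.Gtp} (hy : y ∈ T.tp T.PiCuu) :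
    (T.tp T.PiXuu).map (ThetaOrbitData.innerAutTop y).toMulEquiv.toMonoidHom = T.tp T.PiXuu := by
  ext g
  refine ⟨?_, fun hg => ⟨y⁻¹ * g * y, ?_, ?_⟩⟩
  · rintro ⟨h, hh, rfl⟩
    exact (T.mem_tp_PiXuu_iff_of_mem_tp_PiCuu hy h).1 hh
  · have h := (T.mem_tp_PiXuu_iff_of_mem_tp_PiCuu ((T.tp T.PiCuu).inv_mem hy) g).1 hg
    rwa [inv_inv] at h
  · show y * (y⁻¹ * g * y) * y⁻¹ = g
    group

/-- **`hYuu` from `hY` for `y ∈ Π^tp_{C̲̲}`**: `γ_y(Π^tp_Ÿ ∩ Π^tp_{X̲̲}) = Π^tp_Ÿ ∩ Π^tp_{X̲̲}` as soon as `γ_y(Π^tp_Ÿ) = Π^tp_Ÿ`.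
[cite: MochizukiEtTh2009, Cor 2.8(iii) p.42] -/
theorem map_PiYddtp_inf_tp_PiXuu_innerAutTop_eq_of_mem_tp_PiCuu {y : T.Gtp} (hy : y ∈ T.tp T.PiCuu)
    (hYmap : T.PiYddtp.map (ThetaOrbitData.innerAutTop y).toMulEquiv.toMonoidHom = T.PiYddtp) :
    (T.PiYddtp ⊓ T.tp T.PiXuu).map (ThetaOrbitData.innerAutTop y).toMulEquiv.toMonoidHom = T.PiYddtp ⊓ T.tp T.PiXuu :=
  T.map_PiYddtp_inf_tp_PiXuu_eq _ hYmap (T.map_tp_PiXuu_innerAutTop_eq_of_mem_tp_PiCuu hy)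

end ThetaCovers.TemperedCoverData

namespace SettingModel

variable (p : ℕ) [Fact p.Prime]

section EndKnit

variable {PC : Type} [Group PC] [TopologicalSpace PC] [IsTopologicalGroup PC] [T2Space PC]
variable (e : (MuTwoSetting.inversionModelχ' p).CLevelData)
  (ιC : (MuTwoSetting.inversionModelχ' p).GtpC →ₜ* PC) (hιC : IsProfiniteCompletion ιC)
  (hinj : Function.Injective ιC) (op : (MuTwoSetting.inversionModelχ' p).toThetaSetting.OncePuncturedData)
  {l : ℕ+} (hodd : Odd ((l : ℕ+) : ℕ))
  (s : ↥(MuTwoSetting.inversionModelχ' p).GK →* (MuTwoSetting.inversionModelχ' p).PiTemp)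
  (hsa : ∀ σ, (MuTwoSetting.inversionModelχ' p).aug (s σ) = (σ : GQp p)) (hsZ : ∀ σ, (MuTwoSetting.inversionModelχ' p).toZ (s σ) = 1)
  (hιell : ∀ c ∈ (e.piCDataOf ιC hιC).augGK.ker, c ∉ (e.piCDataOf ιC hιC).PiX →
    ∀ d ∈ (e.piCDataOf ιC hιC).PiX ⊓ (e.piCDataOf ιC hιC).augGK.ker, c * d * c⁻¹ * d ∈ (e.piCDataOf ιC hιC).barTheta l)
  (hN : (((MuTwoSetting.inversionModelχ' p).GtpXu l).map (MuTwoSetting.inversionModelχ' p).inclX).Normal)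
  (hY : ((MuTwoSetting.inversionModelχ' p).GtpY.map (MuTwoSetting.inversionModelχ' p).inclX).Normal)
  {E : (MuTwoSetting.inversionModelχ' p).toThetaSetting.EtaleThetaData} (hE : E.etaDd = etaDdχ p)
  (C : E.DoubleUnderline (l : ℕ)) (hC : C.Huu = Huuχ p l) (hK : (MuTwoSetting.inversionModelχ' p).barKerTp l ≤ C.Huu)
  (hsH : ∀ σ, s σ ∈ C.Huu) (hι : C.IotaStable (e.conjX (epsPMInvχ p))) (τ τ' : ThetaSetting.NonCuspidalPoint E.toKummerData)

/-! ## §2. At the χ′ section-route cover: `hYuu` for EVERY `y ∈ Π^tp_{C̲̲}` -/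

/-- **The binder `hYuu` of `Cor28_i`/`Cor28_iii` is a THEOREM for every `y ∈ Π^tp_{C̲̲}`** at the section-route cover over `χ′` (any
`g ∉ ι(Π^tp_X)` with `IotaStable`): `Π^tp_Ÿ ⊴ Π^tp_C` there (p520114) and §1. [cite: MochizukiEtTh2009, Cor 2.8(iii) p.42] -/
theorem map_PiYddtp_inf_tp_PiXuu_innerAutTop_ofHuuOfSection_of_mem_tp_PiCuu {g : (MuTwoSetting.inversionModelχ' p).GtpC}
    (hgX : g ∉ (MuTwoSetting.inversionModelχ' p).inclX.range) (hιg : C.IotaStable (e.conjX g))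
    {y : (e.temperedCoverDataOfHuuOfSection ιC hιC hinj op hodd s hsa hsZ hιell hN hY C hK hsH hgX hιg).Gtp}
    (hy : y ∈ (e.temperedCoverDataOfHuuOfSection ιC hιC hinj op hodd s hsa hsZ hιell hN hY C hK hsH hgX hιg).tp
      (e.temperedCoverDataOfHuuOfSection ιC hιC hinj op hodd s hsa hsZ hιell hN hY C hK hsH hgX hιg).PiCuu) :
    ((e.temperedCoverDataOfHuuOfSection ιC hιC hinj op hodd s hsa hsZ hιell hN hY C hK hsH hgX hιg).PiYddtp ⊓
        (e.temperedCoverDataOfHuuOfSection ιC hιC hinj op hodd s hsa hsZ hιell hN hY C hK hsH hgX hιg).tp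
          (e.temperedCoverDataOfHuuOfSection ιC hιC hinj op hodd s hsa hsZ hιell hN hY C hK hsH hgX hιg).PiXuu).map
        (ThetaOrbitData.innerAutTop y).toMulEquiv.toMonoidHom =
      (e.temperedCoverDataOfHuuOfSection ιC hιC hinj op hodd s hsa hsZ hιell hN hY C hK hsH hgX hιg).PiYddtp ⊓
        (e.temperedCoverDataOfHuuOfSection ιC hιC hinj op hodd s hsa hsZ hιell hN hY C hK hsH hgX hιg).tp
          (e.temperedCoverDataOfHuuOfSection ιC hιC hinj op hodd s hsa hsZ hιell hN hY C hK hsH hgX hιg).PiXuu :=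
  ThetaCovers.TemperedCoverData.map_PiYddtp_inf_tp_PiXuu_innerAutTop_eq_of_mem_tp_PiCuu _ hy
    (map_PiYddtp_innerAutTop_ofHuuOfSection p e ιC hιC hinj op hodd s hsa hsZ hιell hN hY C hK hsH hgX hιg y)

include hE hC

/-! ## §3. The OUTER end-knit re-keyed: residual `(Γ_Θ, InducesOnTheta)` only -/

/-- **[EtTh] Cor 2.8 (iii), clauses 3–4 of abc-iut-L2-t2's `Cor28_iii` at `ofEmbedding (orbitEmbeddingOfHuuOfSection …)` over `χ′`, for
EVERY conjugator `y ∈ Π^tp_C`, the binders `hY`/`hYuu` DISCHARGED**: «if `γ` arises from an inner automorphism of `Π^tp_{Ċ̲̲}` (resp.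
`Π^tp_{Ċ̲}`), then `γ` preserves `η̲̈^{Θ,l·ℤ}` (resp. `η̈^{Θ,l·ℤ}`)» — residual = `Γ_Θ` with `InducesOnTheta γ_y Γ_Θ` only (P-C5 := abc-iut-w6-d050's
junction; `hY` := §2-normality for every `y`; `hYuu` := §2 from clause 3's own premise; clause 4 via the `hYuu`-free transport of
abc-iut-w6-d049). [cite: MochizukiEtTh2009, Cor 2.8(iii) p.42] -/
theorem cor28_iii_outer_endKnit_inversionModelχ'_of_induces
    (y : (e.temperedCoverDataOfHuuOfSection ιC hιC hinj op hodd s hsa hsZ hιell hN hY C hK hsH (epsPMInvχ_not_mem_range p) hι).Gtp)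
    (ΓΘ : (ThetaOrbitData.ofEmbedding
        (e.orbitEmbeddingOfHuuOfSection ιC hιC hinj op hodd s hsa hsZ hιell hN hY C hK hsH (epsPMInvχ_not_mem_range p) hι τ τ')
        (MuTwoSetting.inversionModelχ'_compat p) (ThetaSetting.modelχ'_sec2Hyps p)).DeltaTheta ≃*
      (ThetaOrbitData.ofEmbedding
        (e.orbitEmbeddingOfHuuOfSection ιC hιC hinj op hodd s hsa hsZ hιell hN hY C hK hsH (epsPMInvχ_not_mem_range p) hι τ τ')
        (MuTwoSetting.inversionModelχ'_compat p) (ThetaSetting.modelχ'_sec2Hyps p)).DeltaTheta)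
    (hind : (ThetaOrbitData.ofEmbedding
        (e.orbitEmbeddingOfHuuOfSection ιC hιC hinj op hodd s hsa hsZ hιell hN hY C hK hsH (epsPMInvχ_not_mem_range p) hι τ τ')
        (MuTwoSetting.inversionModelχ'_compat p) (ThetaSetting.modelχ'_sec2Hyps p)).InducesOnTheta (ThetaOrbitData.innerAutTop y) ΓΘ) :
    (∀ hy : y ∈ (e.temperedCoverDataOfHuuOfSection ιC hιC hinj op hodd s hsa hsZ hιell hN hY C hK hsH (epsPMInvχ_not_mem_range p) hι).tp
          (e.temperedCoverDataOfHuuOfSection ιC hιC hinj op hodd s hsa hsZ hιell hN hY C hK hsH (epsPMInvχ_not_mem_range p) hι).PiCuu ⊓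
        (e.temperedCoverDataOfHuuOfSection ιC hιC hinj op hodd s hsa hsZ hιell hN hY C hK hsH (epsPMInvχ_not_mem_range p) hι).PiCdot,
      (ThetaOrbitData.ofEmbedding
          (e.orbitEmbeddingOfHuuOfSection ιC hιC hinj op hodd s hsa hsZ hιell hN hY C hK hsH (epsPMInvχ_not_mem_range p) hι τ τ')
          (MuTwoSetting.inversionModelχ'_compat p) (ThetaSetting.modelχ'_sec2Hyps p)).transport _ _
          (map_PiYddtp_inf_tp_PiXuu_innerAutTop_ofHuuOfSection_of_mem_tp_PiCuu p e ιC hιC hinj op hodd s hsa hsZ hιell hN hY C hK hsH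
            (epsPMInvχ_not_mem_range p) hι (Subgroup.mem_inf.1 hy).1) ΓΘ
          (ThetaOrbitData.ofEmbedding
            (e.orbitEmbeddingOfHuuOfSection ιC hιC hinj op hodd s hsa hsZ hιell hN hY C hK hsH (epsPMInvχ_not_mem_range p) hι τ τ')
            (MuTwoSetting.inversionModelχ'_compat p) (ThetaSetting.modelχ'_sec2Hyps p)).rootLZ =
        (ThetaOrbitData.ofEmbedding
          (e.orbitEmbeddingOfHuuOfSection ιC hιC hinj op hodd s hsa hsZ hιell hN hY C hK hsH (epsPMInvχ_not_mem_range p) hι τ τ')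
          (MuTwoSetting.inversionModelχ'_compat p) (ThetaSetting.modelχ'_sec2Hyps p)).rootLZ) ∧
    (y ∈ (e.temperedCoverDataOfHuuOfSection ιC hιC hinj op hodd s hsa hsZ hιell hN hY C hK hsH (epsPMInvχ_not_mem_range p) hι).tp
          (e.temperedCoverDataOfHuuOfSection ιC hιC hinj op hodd s hsa hsZ hιell hN hY C hK hsH (epsPMInvχ_not_mem_range p) hι).PiCu ⊓
        (e.temperedCoverDataOfHuuOfSection ιC hιC hinj op hodd s hsa hsZ hιell hN hY C hK hsH (epsPMInvχ_not_mem_range p) hι).PiCdot →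
      (ThetaOrbitData.ofEmbedding
          (e.orbitEmbeddingOfHuuOfSection ιC hιC hinj op hodd s hsa hsZ hιell hN hY C hK hsH (epsPMInvχ_not_mem_range p) hι τ τ')
          (MuTwoSetting.inversionModelχ'_compat p) (ThetaSetting.modelχ'_sec2Hyps p)).transport _ _
          (map_PiYddtp_innerAutTop_ofHuuOfSection p e ιC hιC hinj op hodd s hsa hsZ hιell hN hY C hK hsH (epsPMInvχ_not_mem_range p) hι y) ΓΘ
          (ThetaOrbitData.ofEmbedding
            (e.orbitEmbeddingOfHuuOfSection ιC hιC hinj op hodd s hsa hsZ hιell hN hY C hK hsH (epsPMInvχ_not_mem_range p) hι τ τ')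
            (MuTwoSetting.inversionModelχ'_compat p) (ThetaSetting.modelχ'_sec2Hyps p)).etaLZ =
        (ThetaOrbitData.ofEmbedding
          (e.orbitEmbeddingOfHuuOfSection ιC hιC hinj op hodd s hsa hsZ hιell hN hY C hK hsH (epsPMInvχ_not_mem_range p) hι τ τ')
          (MuTwoSetting.inversionModelχ'_compat p) (ThetaSetting.modelχ'_sec2Hyps p)).etaLZ) := by
  have hYmap := map_PiYddtp_innerAutTop_ofHuuOfSection p e ιC hιC hinj op hodd s hsa hsZ hιell hN hY C hK hsH (epsPMInvχ_not_mem_range p) hι y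
  refine ⟨fun hy => ?_, fun hy => ?_⟩
  · -- clause 3: abc-iut-w6-d050's end-knit, both binders supplied (`hYuu` read off the premise `y ∈ Π^tp_{C̲̲}`)
    exact (cor28_iii_outer_endKnit_inversionModelχ' p e ιC hιC hinj op hodd s hsa hsZ hιell hN hY hE C hC hK hsH hι τ τ' y ΓΘ hind hYmap
      (map_PiYddtp_inf_tp_PiXuu_innerAutTop_ofHuuOfSection_of_mem_tp_PiCuu p e ιC hιC hinj op hodd s hsa hsZ hιell hN hY C hK hsH
        (epsPMInvχ_not_mem_range p) hι (Subgroup.mem_inf.1 hy).1)).1 hy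
  · -- clause 4, `hYuu`-free (the path of abc-iut-w6-d051's `ofEmbedding_cor28_iii_outer_reduced`, P-C5 from abc-iut-w6-d050's junction)
    haveI := (MuTwoSetting.inversionModelχ'_compat p).GtpYdd_normal
    have hα := fun σ => e.orbitEmbeddingOfHuuOfSection_ι_conjX ιC hιC hinj op hodd s hsa hsZ hιell hN hY C hK hsH (epsPMInvχ_not_mem_range p)
      hι τ τ' y σ
    have hβ := e.orbitEmbeddingOfHuu_topCompanion_toTheta (isQuotientMap_toTheta_inversionModelχ' p) y
    obtain ⟨hΔ, hΔ'⟩ := (e.orbitEmbeddingOfHuuOfSection ιC hιC hinj op hodd s hsa hsZ hιell hN hY C hK hsH (epsPMInvχ_not_mem_range p)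
      hι τ τ').stab_DeltaTheta_of_induces (MuTwoSetting.inversionModelχ'_compat p) (ThetaSetting.modelχ'_sec2Hyps p) hα hβ hind
    obtain ⟨hYs, hYs'⟩ := (e.orbitEmbeddingOfHuuOfSection ιC hιC hinj op hodd s hsa hsZ hιell hN hY C hK hsH (epsPMInvχ_not_mem_range p)
      hι τ τ').stab_GtpYdd_of_map_PiYddtp hα hYmap
    obtain ⟨hXu, hXu'⟩ := (e.orbitEmbeddingOfHuuOfSection ιC hιC hinj op hodd s hsa hsZ hιell hN hY C hK hsH (epsPMInvχ_not_mem_range p)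
      hι τ τ').stab_GtpXu_of_mem_tp_PiCu (e.orbitEmbeddingOfHuuOfSection_map_GtpXu ιC hιC hinj op hodd s hsa hsZ hιell hN hY C hK hsH
        (epsPMInvχ_not_mem_range p) hι τ τ') hα (Subgroup.mem_inf.1 hy).1
    obtain ⟨σ, hσ, hησ⟩ := exists_mem_dotXuu_pC5_inversionModelχ' p e ιC hιC hinj op hodd s hsa hsZ hιell hN hY hE C hC hK hsH hι τ τ' y
      (Subgroup.mem_inf.1 hy).1
    exact (e.orbitEmbeddingOfHuuOfSection ιC hιC hinj op hodd s hsa hsZ hιell hN hY C hK hsH (epsPMInvχ_not_mem_range p)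
      hι τ τ').ofEmbedding_transport_outer_etaLZ (MuTwoSetting.inversionModelχ'_compat p) (ThetaSetting.modelχ'_sec2Hyps p)
      (Subgroup.mem_inf.1 hy).2 hα hβ hΔ hΔ' hYs hYs' hXu hXu' ΓΘ hind hYmap ⟨C.Huu_le_GtpXu hσ.1, hσ.2⟩ (hησ hΔ' hYs)

/-! ## §4 (v2). The INNER twin: clauses 1–2 re-keyed, residual `(Γ_Θ, InducesOnTheta)` only (any `g ∉ ι(Π^tp_X)`) -/

omit hE hC in
/-- **[EtTh] Cor 2.8 (iii), clauses 1–2 of abc-iut-L2-t2's `Cor28_iii` at `ofEmbedding (orbitEmbeddingOfHuuOfSection …)` over `χ′`, for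
EVERY conjugator `y ∈ Π^tp_C`, the binders `hY`/`hYuu` DISCHARGED** (any `g ∉ ι(Π^tp_X)` with `IotaStable`): «if `γ` arises from an inner
automorphism of `Π^tp_{Ẋ̲̲}` (resp. `Π^tp_{Ẋ̲}`), then `γ` preserves `η̲̈^{Θ,l·ℤ}` (resp. `η̈^{Θ,l·ℤ}`)» — abc-iut-L2-t2's clause-wise
`ofEmbedding_transport_inner_rootLZ` / `…_etaLZ` (p427195) with `hYuu` := §2 read off clause 1's premise (`Π^tp_{X̲̲} ≤ Π^tp_{C̲̲}`,
`tp_PiXuu_le_tp_PiCuu`), `hY` := §2-normality, `ι(Π^tp_{X̲}) = T.tp T.PiXu` := abc-iut-w6-d049's `orbitEmbeddingOfHuuOfSection_map_GtpXu`.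
[cite: MochizukiEtTh2009, Cor 2.8(iii) p.42] -/
theorem cor28_iii_inner_endKnit_inversionModelχ'_of_induces {g : (MuTwoSetting.inversionModelχ' p).GtpC}
    (hgX : g ∉ (MuTwoSetting.inversionModelχ' p).inclX.range) (hιg : C.IotaStable (e.conjX g))
    (y : (e.temperedCoverDataOfHuuOfSection ιC hιC hinj op hodd s hsa hsZ hιell hN hY C hK hsH hgX hιg).Gtp)
    (ΓΘ : (ThetaOrbitData.ofEmbedding (e.orbitEmbeddingOfHuuOfSection ιC hιC hinj op hodd s hsa hsZ hιell hN hY C hK hsH hgX hιg τ τ')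
        (MuTwoSetting.inversionModelχ'_compat p) (ThetaSetting.modelχ'_sec2Hyps p)).DeltaTheta ≃*
      (ThetaOrbitData.ofEmbedding (e.orbitEmbeddingOfHuuOfSection ιC hιC hinj op hodd s hsa hsZ hιell hN hY C hK hsH hgX hιg τ τ')
        (MuTwoSetting.inversionModelχ'_compat p) (ThetaSetting.modelχ'_sec2Hyps p)).DeltaTheta)
    (hind : (ThetaOrbitData.ofEmbedding (e.orbitEmbeddingOfHuuOfSection ιC hιC hinj op hodd s hsa hsZ hιell hN hY C hK hsH hgX hιg τ τ')
        (MuTwoSetting.inversionModelχ'_compat p) (ThetaSetting.modelχ'_sec2Hyps p)).InducesOnTheta (ThetaOrbitData.innerAutTop y) ΓΘ) :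
    (∀ hy : y ∈ (e.temperedCoverDataOfHuuOfSection ιC hιC hinj op hodd s hsa hsZ hιell hN hY C hK hsH hgX hιg).tp
          (e.temperedCoverDataOfHuuOfSection ιC hιC hinj op hodd s hsa hsZ hιell hN hY C hK hsH hgX hιg).PiXuu ⊓
        (e.temperedCoverDataOfHuuOfSection ιC hιC hinj op hodd s hsa hsZ hιell hN hY C hK hsH hgX hιg).PiCdot,
      (ThetaOrbitData.ofEmbedding (e.orbitEmbeddingOfHuuOfSection ιC hιC hinj op hodd s hsa hsZ hιell hN hY C hK hsH hgX hιg τ τ')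
          (MuTwoSetting.inversionModelχ'_compat p) (ThetaSetting.modelχ'_sec2Hyps p)).transport _ _
          (map_PiYddtp_inf_tp_PiXuu_innerAutTop_ofHuuOfSection_of_mem_tp_PiCuu p e ιC hιC hinj op hodd s hsa hsZ hιell hN hY C hK hsH
            hgX hιg ((e.temperedCoverDataOfHuuOfSection ιC hιC hinj op hodd s hsa hsZ hιell hN hY C hK hsH hgX hιg).tp_PiXuu_le_tp_PiCuu
              (Subgroup.mem_inf.1 hy).1)) ΓΘ
          (ThetaOrbitData.ofEmbedding (e.orbitEmbeddingOfHuuOfSection ιC hιC hinj op hodd s hsa hsZ hιell hN hY C hK hsH hgX hιg τ τ')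
            (MuTwoSetting.inversionModelχ'_compat p) (ThetaSetting.modelχ'_sec2Hyps p)).rootLZ =
        (ThetaOrbitData.ofEmbedding (e.orbitEmbeddingOfHuuOfSection ιC hιC hinj op hodd s hsa hsZ hιell hN hY C hK hsH hgX hιg τ τ')
          (MuTwoSetting.inversionModelχ'_compat p) (ThetaSetting.modelχ'_sec2Hyps p)).rootLZ) ∧
    (y ∈ (e.temperedCoverDataOfHuuOfSection ιC hιC hinj op hodd s hsa hsZ hιell hN hY C hK hsH hgX hιg).tp
          (e.temperedCoverDataOfHuuOfSection ιC hιC hinj op hodd s hsa hsZ hιell hN hY C hK hsH hgX hιg).PiXu ⊓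
        (e.temperedCoverDataOfHuuOfSection ιC hιC hinj op hodd s hsa hsZ hιell hN hY C hK hsH hgX hιg).PiCdot →
      (ThetaOrbitData.ofEmbedding (e.orbitEmbeddingOfHuuOfSection ιC hιC hinj op hodd s hsa hsZ hιell hN hY C hK hsH hgX hιg τ τ')
          (MuTwoSetting.inversionModelχ'_compat p) (ThetaSetting.modelχ'_sec2Hyps p)).transport _ _
          (map_PiYddtp_innerAutTop_ofHuuOfSection p e ιC hιC hinj op hodd s hsa hsZ hιell hN hY C hK hsH hgX hιg y) ΓΘ
          (ThetaOrbitData.ofEmbedding (e.orbitEmbeddingOfHuuOfSection ιC hιC hinj op hodd s hsa hsZ hιell hN hY C hK hsH hgX hιg τ τ')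
            (MuTwoSetting.inversionModelχ'_compat p) (ThetaSetting.modelχ'_sec2Hyps p)).etaLZ =
        (ThetaOrbitData.ofEmbedding (e.orbitEmbeddingOfHuuOfSection ιC hιC hinj op hodd s hsa hsZ hιell hN hY C hK hsH hgX hιg τ τ')
          (MuTwoSetting.inversionModelχ'_compat p) (ThetaSetting.modelχ'_sec2Hyps p)).etaLZ) :=
  ⟨fun hy => ThetaOrbitData.ofEmbedding_transport_inner_rootLZ _ _ _ hy ΓΘ hind _,
    fun hy => ThetaOrbitData.ofEmbedding_transport_inner_etaLZ _ _ _
      (e.orbitEmbeddingOfHuuOfSection_map_GtpXu ιC hιC hinj op hodd s hsa hsZ hιell hN hY C hK hsH hgX hιg τ τ') hy ΓΘ hind _⟩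

/-! ## §5 (v2). Cor 2.8 (iii) in PRINT SHAPE at the χ′ cover of record: all four clauses, NO stability proviso -/

/-- **[EtTh] Cor 2.8 (iii) in PRINT SHAPE at `ofEmbedding (orbitEmbeddingOfHuuOfSection …)` over `χ′`** (section-route cover, `g := ε_±`):
for EVERY conjugator `y ∈ Π^tp_C` and every coefficient automorphism `Γ_Θ` induced by `γ_y` (there is exactly one, p520114), ALL FOUR
clauses — «if `γ` arises from an inner automorphism of `Π^tp_{Ẋ̲̲}` (resp. `Π^tp_{Ẋ̲}`; `Π^tp_{Ċ̲̲}`; `Π^tp_{Ċ̲}`), then `γ` preserves `η̲̈^{Θ,l·ℤ}`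
(resp. `η̈^{Θ,l·ℤ}`; `η̲̈^{Θ,l·ℤ}`; `η̈^{Θ,l·ℤ}`)» — WITHOUT the stability provisos `hY`/`hYuu` that abc-iut-L2-t2's `Cor28_iii` carries as
hypotheses (they are theorems where used: §2, §4); §4 + §3.  `Cor28_iii` AS TYPED at this cover (abc-iut-w6-d049's
`cor28_iii_endKnit_inversionModelχ'`) is the special case that only speaks for conjugators supplied with both provisos.
[cite: MochizukiEtTh2009, Cor 2.8(iii) p.42] -/
theorem cor28_iii_printShape_inversionModelχ'_of_induces
    (y : (e.temperedCoverDataOfHuuOfSection ιC hιC hinj op hodd s hsa hsZ hιell hN hY C hK hsH (epsPMInvχ_not_mem_range p) hι).Gtp)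
    (ΓΘ : (ThetaOrbitData.ofEmbedding
        (e.orbitEmbeddingOfHuuOfSection ιC hιC hinj op hodd s hsa hsZ hιell hN hY C hK hsH (epsPMInvχ_not_mem_range p) hι τ τ')
        (MuTwoSetting.inversionModelχ'_compat p) (ThetaSetting.modelχ'_sec2Hyps p)).DeltaTheta ≃*
      (ThetaOrbitData.ofEmbedding
        (e.orbitEmbeddingOfHuuOfSection ιC hιC hinj op hodd s hsa hsZ hιell hN hY C hK hsH (epsPMInvχ_not_mem_range p) hι τ τ')
        (MuTwoSetting.inversionModelχ'_compat p) (ThetaSetting.modelχ'_sec2Hyps p)).DeltaTheta)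
    (hind : (ThetaOrbitData.ofEmbedding
        (e.orbitEmbeddingOfHuuOfSection ιC hιC hinj op hodd s hsa hsZ hιell hN hY C hK hsH (epsPMInvχ_not_mem_range p) hι τ τ')
        (MuTwoSetting.inversionModelχ'_compat p) (ThetaSetting.modelχ'_sec2Hyps p)).InducesOnTheta (ThetaOrbitData.innerAutTop y) ΓΘ) :
    (∀ hy : y ∈ (e.temperedCoverDataOfHuuOfSection ιC hιC hinj op hodd s hsa hsZ hιell hN hY C hK hsH (epsPMInvχ_not_mem_range p) hι).tp
          (e.temperedCoverDataOfHuuOfSection ιC hιC hinj op hodd s hsa hsZ hιell hN hY C hK hsH (epsPMInvχ_not_mem_range p) hι).PiXuu ⊓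
        (e.temperedCoverDataOfHuuOfSection ιC hιC hinj op hodd s hsa hsZ hιell hN hY C hK hsH (epsPMInvχ_not_mem_range p) hι).PiCdot,
      (ThetaOrbitData.ofEmbedding
          (e.orbitEmbeddingOfHuuOfSection ιC hιC hinj op hodd s hsa hsZ hιell hN hY C hK hsH (epsPMInvχ_not_mem_range p) hι τ τ')
          (MuTwoSetting.inversionModelχ'_compat p) (ThetaSetting.modelχ'_sec2Hyps p)).transport _ _
          (map_PiYddtp_inf_tp_PiXuu_innerAutTop_ofHuuOfSection_of_mem_tp_PiCuu p e ιC hιC hinj op hodd s hsa hsZ hιell hN hY C hK hsH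
            (epsPMInvχ_not_mem_range p) hι ((e.temperedCoverDataOfHuuOfSection ιC hιC hinj op hodd s hsa hsZ hιell hN hY C hK hsH
              (epsPMInvχ_not_mem_range p) hι).tp_PiXuu_le_tp_PiCuu (Subgroup.mem_inf.1 hy).1)) ΓΘ
          (ThetaOrbitData.ofEmbedding
            (e.orbitEmbeddingOfHuuOfSection ιC hιC hinj op hodd s hsa hsZ hιell hN hY C hK hsH (epsPMInvχ_not_mem_range p) hι τ τ')
            (MuTwoSetting.inversionModelχ'_compat p) (ThetaSetting.modelχ'_sec2Hyps p)).rootLZ =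
        (ThetaOrbitData.ofEmbedding
          (e.orbitEmbeddingOfHuuOfSection ιC hιC hinj op hodd s hsa hsZ hιell hN hY C hK hsH (epsPMInvχ_not_mem_range p) hι τ τ')
          (MuTwoSetting.inversionModelχ'_compat p) (ThetaSetting.modelχ'_sec2Hyps p)).rootLZ) ∧
    (y ∈ (e.temperedCoverDataOfHuuOfSection ιC hιC hinj op hodd s hsa hsZ hιell hN hY C hK hsH (epsPMInvχ_not_mem_range p) hι).tp
          (e.temperedCoverDataOfHuuOfSection ιC hιC hinj op hodd s hsa hsZ hιell hN hY C hK hsH (epsPMInvχ_not_mem_range p) hι).PiXu ⊓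
        (e.temperedCoverDataOfHuuOfSection ιC hιC hinj op hodd s hsa hsZ hιell hN hY C hK hsH (epsPMInvχ_not_mem_range p) hι).PiCdot →
      (ThetaOrbitData.ofEmbedding
          (e.orbitEmbeddingOfHuuOfSection ιC hιC hinj op hodd s hsa hsZ hιell hN hY C hK hsH (epsPMInvχ_not_mem_range p) hι τ τ')
          (MuTwoSetting.inversionModelχ'_compat p) (ThetaSetting.modelχ'_sec2Hyps p)).transport _ _
          (map_PiYddtp_innerAutTop_ofHuuOfSection p e ιC hιC hinj op hodd s hsa hsZ hιell hN hY C hK hsH (epsPMInvχ_not_mem_range p) hι y) ΓΘ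
          (ThetaOrbitData.ofEmbedding
            (e.orbitEmbeddingOfHuuOfSection ιC hιC hinj op hodd s hsa hsZ hιell hN hY C hK hsH (epsPMInvχ_not_mem_range p) hι τ τ')
            (MuTwoSetting.inversionModelχ'_compat p) (ThetaSetting.modelχ'_sec2Hyps p)).etaLZ =
        (ThetaOrbitData.ofEmbedding
          (e.orbitEmbeddingOfHuuOfSection ιC hιC hinj op hodd s hsa hsZ hιell hN hY C hK hsH (epsPMInvχ_not_mem_range p) hι τ τ')
          (MuTwoSetting.inversionModelχ'_compat p) (ThetaSetting.modelχ'_sec2Hyps p)).etaLZ) ∧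
    (∀ hy : y ∈ (e.temperedCoverDataOfHuuOfSection ιC hιC hinj op hodd s hsa hsZ hιell hN hY C hK hsH (epsPMInvχ_not_mem_range p) hι).tp
          (e.temperedCoverDataOfHuuOfSection ιC hιC hinj op hodd s hsa hsZ hιell hN hY C hK hsH (epsPMInvχ_not_mem_range p) hι).PiCuu ⊓
        (e.temperedCoverDataOfHuuOfSection ιC hιC hinj op hodd s hsa hsZ hιell hN hY C hK hsH (epsPMInvχ_not_mem_range p) hι).PiCdot,
      (ThetaOrbitData.ofEmbedding
          (e.orbitEmbeddingOfHuuOfSection ιC hιC hinj op hodd s hsa hsZ hιell hN hY C hK hsH (epsPMInvχ_not_mem_range p) hι τ τ')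
          (MuTwoSetting.inversionModelχ'_compat p) (ThetaSetting.modelχ'_sec2Hyps p)).transport _ _
          (map_PiYddtp_inf_tp_PiXuu_innerAutTop_ofHuuOfSection_of_mem_tp_PiCuu p e ιC hιC hinj op hodd s hsa hsZ hιell hN hY C hK hsH
            (epsPMInvχ_not_mem_range p) hι (Subgroup.mem_inf.1 hy).1) ΓΘ
          (ThetaOrbitData.ofEmbedding
            (e.orbitEmbeddingOfHuuOfSection ιC hιC hinj op hodd s hsa hsZ hιell hN hY C hK hsH (epsPMInvχ_not_mem_range p) hι τ τ')
            (MuTwoSetting.inversionModelχ'_compat p) (ThetaSetting.modelχ'_sec2Hyps p)).rootLZ =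
        (ThetaOrbitData.ofEmbedding
          (e.orbitEmbeddingOfHuuOfSection ιC hιC hinj op hodd s hsa hsZ hιell hN hY C hK hsH (epsPMInvχ_not_mem_range p) hι τ τ')
          (MuTwoSetting.inversionModelχ'_compat p) (ThetaSetting.modelχ'_sec2Hyps p)).rootLZ) ∧
    (y ∈ (e.temperedCoverDataOfHuuOfSection ιC hιC hinj op hodd s hsa hsZ hιell hN hY C hK hsH (epsPMInvχ_not_mem_range p) hι).tp
          (e.temperedCoverDataOfHuuOfSection ιC hιC hinj op hodd s hsa hsZ hιell hN hY C hK hsH (epsPMInvχ_not_mem_range p) hι).PiCu ⊓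
        (e.temperedCoverDataOfHuuOfSection ιC hιC hinj op hodd s hsa hsZ hιell hN hY C hK hsH (epsPMInvχ_not_mem_range p) hι).PiCdot →
      (ThetaOrbitData.ofEmbedding
          (e.orbitEmbeddingOfHuuOfSection ιC hιC hinj op hodd s hsa hsZ hιell hN hY C hK hsH (epsPMInvχ_not_mem_range p) hι τ τ')
          (MuTwoSetting.inversionModelχ'_compat p) (ThetaSetting.modelχ'_sec2Hyps p)).transport _ _
          (map_PiYddtp_innerAutTop_ofHuuOfSection p e ιC hιC hinj op hodd s hsa hsZ hιell hN hY C hK hsH (epsPMInvχ_not_mem_range p) hι y) ΓΘ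
          (ThetaOrbitData.ofEmbedding
            (e.orbitEmbeddingOfHuuOfSection ιC hιC hinj op hodd s hsa hsZ hιell hN hY C hK hsH (epsPMInvχ_not_mem_range p) hι τ τ')
            (MuTwoSetting.inversionModelχ'_compat p) (ThetaSetting.modelχ'_sec2Hyps p)).etaLZ =
        (ThetaOrbitData.ofEmbedding
          (e.orbitEmbeddingOfHuuOfSection ιC hιC hinj op hodd s hsa hsZ hιell hN hY C hK hsH (epsPMInvχ_not_mem_range p) hι τ τ')
          (MuTwoSetting.inversionModelχ'_compat p) (ThetaSetting.modelχ'_sec2Hyps p)).etaLZ) :=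
  have hin := cor28_iii_inner_endKnit_inversionModelχ'_of_induces p e ιC hιC hinj op hodd s hsa hsZ hιell hN hY C hK hsH τ τ'
    (epsPMInvχ_not_mem_range p) hι y ΓΘ hind
  have hout := cor28_iii_outer_endKnit_inversionModelχ'_of_induces p e ιC hιC hinj op hodd s hsa hsZ hιell hN hY hE C hC hK hsH hι τ τ'
    y ΓΘ hind
  ⟨hin.1, hin.2, hout.1, hout.2⟩

end EndKnit

end SettingModel

end Literature.AnabelianGeometry.EtaleTheta

end
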